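import Literature.NumberTheory.LFunctions.RiemannSiegelStirling
import Literature.Analysis.SpecialFunctions.GammaRatioStirling
import HarnessLib

/-!
# Second-order Stirling for `ψ` off the real axis and the Stirling form of `Γ(w₀+d)/Γ(w₀)`

Topic: `Literature/Analysis/SpecialFunctions` (companion of `DigammaGauss.lean`,
`GammaRatioStirling.lean` and of `Literature/NumberTheory/LFunctions/RiemannSiegelStirling.lean`).
Everything here is proved; no named facts.

The tree has the second-order vertical Stirling bound for the *real part* of the digamma function,
`Literature.NumberTheory.LFunctions.Complex.abs_re_digamma_sub_log_norm_add_re_le`: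
`|Re ψ(w) − log ‖w‖ + Re 1/(2w)| ≤ 1/(6|Im w|³) + π/(12 (Im w)²)` (`Re w > 0`, `Im w ≠ 0`), by the
trapezoid rule applied to Gauss's formula `ψ(w) = lim (log n − Σ_{j≤n} 1/(w+j))`. This file adds

* `abs_im_digamma_sub_arg_add_im_le` — the same bound for the **imaginary part**:
  `|Im ψ(w) − Arg w + Im 1/(2w)| ≤ 1/(6|Im w|³) + π/(12 (Im w)²)` for `Re w > 0`, `Im w > 0`
  (trapezoid rule for `u ↦ Im 1/(w+u)`, whose integral over `[0, ∞)` is `−Arg w`);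
* `norm_digamma_sub_log_add_inv_le` — hence the complex second-order Stirling bound
  `‖ψ(w) − Log w + 1/(2w)‖ ≤ 2 (1/(6|Im w|³) + π/(12 (Im w)²))` on the open first quadrant;
* `stirlingPrim w = (w − ½) Log w − w`, the primitive of `Log w − 1/(2w)` on the slit plane
  (`hasDerivAt_stirlingPrim`), and the **Stirling form of the `Γ`-ratio along a segment** in the
  upper half-plane: if `‖ψ − Log + 1/(2·)‖ ≤ ε` on `[w₀, w₀+d]` then
  `Γ(w₀+d) = Γ(w₀) · exp(stirlingPrim(w₀+d) − stirlingPrim(w₀) + E)` with `‖E‖ ≤ ε ‖d‖`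
  (`Gamma_eq_mul_exp_stirlingPrim`; the first-order analogue with the Taylor polynomial of
  `w Log w − w` is the tree's `Gamma_eq_mul_exp_taylor`), together with the horizontal-segment
  packaging `Gamma_eq_mul_exp_stirlingPrim_horizontal` (error `2δ(1/(6b³) + π/(12b²))`,
  `b = Im w₀`, `δ ≥ 0` the length).

These are the ingredients of certified evaluations of `Γ(w)/Γ(w+½)` at large height (e.g. the
factor `Γ(s/2)/Γ((s+1)/2)` of `ξ(s)/ξ(s+1)`, `Literature/Barriers/RiemannHypothesis/DeBrangesPositivityCert.lean`).

## References

* E. T. Whittaker, G. N. Watson, *A Course of Modern Analysis*, 4th ed., §12.33 (the expansion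
  `ψ(w) = log w − 1/(2w) − Σ B_{2k}/(2k w^{2k})`), §12.31–12.32 (Binet, Stirling's series).
* G. E. Andrews, R. Askey, R. Roy, *Special Functions* (1999), Thm. 1.2.5 (Gauss's formula).
-/

noncomputable section

open Complex Real Set Filter Topology MeasureTheory intervalIntegral

open Literature.NumberTheory.LFunctions.Complex (hasDerivAt_one_div_add_ofReal
  add_ofReal_ne_zero hasDerivAt_neg_one_div_sq_add_ofReal norm_add_ofReal_mono
  sum_range_succ_eq_sum_trapezoid abs_re_digamma_sub_log_norm_add_re_le)
open Literature.NumberTheory.LFunctions (hasDerivAt_im_comp)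

namespace Literature.Analysis.SpecialFunctions.Complex

/-! ### The kernel `u ↦ Im 1/(w+u)` -/

/-- `Im (1/(w+u)) = −Im w/((Re w + u)² + (Im w)²)`. [folklore] -/
lemma im_one_div_add_ofReal (w : ℂ) (u : ℝ) :
    (1 / (w + u)).im = -w.im / ((w.re + u) ^ 2 + w.im ^ 2) := by
  rw [one_div, inv_im, normSq_apply]
  simp only [add_re, ofReal_re, add_im, ofReal_im, add_zero]
  ring

/-- The kernel `u ↦ Im 1/(w+u)` is smooth on `ℝ` when `Im w ≠ 0`. [folklore] -/
lemma contDiff_im_one_div_add {w : ℂ} (hy : w.im ≠ 0) {n : WithTop ℕ∞} :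
    ContDiff ℝ n (fun u : ℝ ↦ (1 / (w + u)).im) := by
  have hfun : (fun u : ℝ ↦ (1 / (w + u)).im) = fun u ↦ -w.im / ((w.re + u) ^ 2 + w.im ^ 2) :=
    funext fun u ↦ im_one_div_add_ofReal w u
  rw [hfun]
  refine ContDiff.div (by fun_prop) (by fun_prop) fun u ↦ ?_
  have : 0 < w.im ^ 2 := by positivity
  positivity

/-- `(Im 1/(w+u))' = Im (−1/(w+u)²)`. [folklore] -/
lemma deriv_im_one_div_add {w : ℂ} (hy : w.im ≠ 0) :
    deriv (fun u : ℝ ↦ (1 / (w + u)).im) = fun u ↦ (-1 / (w + u) ^ 2).im :=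
  funext fun u ↦
    (hasDerivAt_im_comp (hasDerivAt_one_div_add_ofReal (add_ofReal_ne_zero hy u))).deriv

/-- `(Im 1/(w+u))'' = Im (2/(w+u)³)`. [folklore] -/
lemma iteratedDeriv_two_im_one_div_add {w : ℂ} (hy : w.im ≠ 0) :
    iteratedDeriv 2 (fun u : ℝ ↦ (1 / (w + u)).im) = fun u ↦ (2 / (w + u) ^ 3).im := by
  rw [iteratedDeriv_succ, iteratedDeriv_one, deriv_im_one_div_add hy]
  exact funext fun u ↦
    (hasDerivAt_im_comp (hasDerivAt_neg_one_div_sq_add_ofReal (add_ofReal_ne_zero hy u))).deriv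

/-- **Trapezoid error on one unit interval** for `g(u) = Im 1/(w+u)`: for `Re w > 0`, `Im w ≠ 0`,
`k ≥ 0`, `|(g(k) + g(k+1))/2 − ∫ₖ^{k+1} g| ≤ 1/(6 ‖w+k‖³)` (`|g''| ≤ 2/‖w+k‖³` on `[k, k+1]` and
Mathlib's `trapezoidal_error_le`). [folklore] -/
lemma abs_trapezoid_im_one_div_le {w : ℂ} (hw : 0 < w.re) (hy : w.im ≠ 0) {k : ℝ} (hk : 0 ≤ k) :
    |((1 / (w + k)).im + (1 / (w + (k + 1 : ℝ))).im) / 2 -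
        ∫ u in k..(k + 1), (1 / (w + u)).im| ≤ 1 / (6 * ‖w + k‖ ^ 3) := by
  set g : ℝ → ℝ := fun u ↦ (1 / (w + u)).im with hg
  have hcd : ContDiff ℝ 2 g := contDiff_im_one_div_add hy
  have hpos : 0 < ‖w + k‖ := norm_add_ofReal_pos hw hk
  have hbound : ∀ x, |iteratedDerivWithin 2 g (uIcc k (k + 1)) x| ≤ 2 / ‖w + k‖ ^ 3 := by
    intro x
    rw [uIcc_of_le (by linarith)]
    by_cases hx : x ∈ Icc k (k + 1)
    · rw [iteratedDerivWithin_eq_iteratedDeriv (uniqueDiffOn_Icc (by linarith)) hcd.contDiffAt hx,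
        iteratedDeriv_two_im_one_div_add hy]
      have hxk : ‖w + k‖ ≤ ‖w + x‖ := norm_add_ofReal_mono hw hk hx.1
      have hx0 : 0 < ‖w + x‖ := hpos.trans_le hxk
      calc |(2 / (w + x) ^ 3).im| ≤ ‖2 / (w + x) ^ 3‖ := abs_im_le_norm _
        _ = 2 / ‖w + x‖ ^ 3 := by simp [norm_pow]
        _ ≤ 2 / ‖w + k‖ ^ 3 := by
          apply div_le_div_of_nonneg_left (by norm_num) (by positivity)
          exact pow_le_pow_left₀ hpos.le hxk 3
    · rw [iteratedDerivWithin_succ, derivWithin_zero_of_notMem_closure (by rwa [closure_Icc]),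
        abs_zero]
      positivity
  have h := trapezoidal_error_le (f := g) (a := k) (b := k + 1)
    (hcd.differentiable (by norm_num)).differentiableOn ?_ hbound (N := 1) one_pos
  · rw [trapezoidal_error, trapezoidal_integral_one] at h
    have e : |k + 1 - k| ^ 3 * (2 / ‖w + k‖ ^ 3) / (12 * (1 : ℕ) ^ 2) = 1 / (6 * ‖w + k‖ ^ 3) := by
      norm_num; ring
    rw [e] at h
    convert h using 2
    simp [hg]
    ring
  · rw [uIcc_of_le (by linarith)]
    have hd : Differentiable ℝ (deriv g) := by
      have := hcd.differentiable_iteratedDeriv 1 (by norm_num)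
      rwa [iteratedDeriv_one] at this
    intro x hx
    have heq : EqOn (derivWithin g (Icc k (k + 1))) (deriv g) (Icc k (k + 1)) := fun y hy ↦
      (hcd.differentiable (by norm_num) y).derivWithin (uniqueDiffOn_Icc (by linarith) y hy)
    exact ((hd x).differentiableWithinAt).congr heq (heq hx)

/-! ### `Arg` in the open right half-plane -/

/-- For `Re z > 0`: `Arg z = arctan (Im z / Re z)`. [folklore] -/
theorem arg_eq_arctan_of_re_pos {z : ℂ} (hz : 0 < z.re) : arg z = Real.arctan (z.im / z.re) := by
  have h1 : |arg z| < π / 2 := Complex.abs_arg_lt_pi_div_two_iff.2 (Or.inl hz)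
  rw [← Complex.tan_arg]
  exact (Real.arctan_tan (abs_lt.1 h1).1 (abs_lt.1 h1).2).symm

/-- For `Re z > 0`, `Im z > 0`: `Arg z = π/2 − arctan (Re z / Im z)`. [folklore] -/
theorem arg_eq_pi_div_two_sub_arctan {z : ℂ} (hz : 0 < z.re) (hy : 0 < z.im) :
    arg z = π / 2 - Real.arctan (z.re / z.im) := by
  rw [arg_eq_arctan_of_re_pos hz, ← Real.arctan_inv_of_pos (div_pos hz hy), inv_div]

/-! ### The second-order bound for `Im ψ` -/

/-- **Second-order Stirling bound for `Im ψ` on vertical lines.** For `0 < Re w`, `0 < Im w`: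
`|Im ψ(w) − Arg w + Im (1/(2w))| ≤ 1/(6|Im w|³) + π/(12 (Im w)²)`.
From Gauss's formula `ψ(w) = lim (log n − Σ_{j≤n} 1/(w+j))`, comparing `Σ_{j≤n} Im 1/(w+j)` with
`∫₀ⁿ Im 1/(w+u) du = −(arctan((Re w+n)/Im w) − arctan(Re w/Im w)) → −Arg w` by the trapezoid rule
on each `[k, k+1]` (`abs_trapezoid_im_one_div_le`), the end-point correction `g(0)/2 = Im 1/(2w)`
being the second Stirling term (cf. the real part,
`Literature.NumberTheory.LFunctions.Complex.abs_re_digamma_sub_log_norm_add_re_le`, and the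
first-order two-sided comparison `arg_le_im_digamma`). [folklore] -/
theorem abs_im_digamma_sub_arg_add_im_le {w : ℂ} (hw : 0 < w.re) (hy : 0 < w.im) :
    |(digamma w).im - arg w + (1 / (2 * w)).im| ≤
      1 / (6 * |w.im| ^ 3) + π / (12 * w.im ^ 2) := by
  set g : ℝ → ℝ := fun u ↦ (1 / (w + u)).im with hg
  set B : ℝ := 1 / (6 * |w.im| ^ 3) + π / (12 * w.im ^ 2) with hB
  have hy' : w.im ≠ 0 := hy.ne'
  have hτ : 0 < |w.im| := abs_pos.2 hy'
  -- `g` versus the arctan kernel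
  have hgf : ∀ u : ℝ, g u = -(w.im / ((w.re + u) ^ 2 + w.im ^ 2)) := fun u ↦ by
    simp only [hg, im_one_div_add_ofReal, neg_div]
  -- imaginary part of Gauss's formula
  have ha : Tendsto (fun n : ℕ ↦ -∑ j ∈ Finset.range (n + 1), g j) atTop
      (𝓝 (digamma w).im) := by
    have := (continuous_im.tendsto _).comp (tendsto_log_sub_sum_inv_digamma hw)
    refine this.congr fun n ↦ ?_
    simp only [Function.comp_apply, Complex.sub_im, Complex.ofReal_im, Complex.im_sum, g,
      Complex.ofReal_natCast, zero_sub]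
  -- the integrals over unit intervals add up to an arctan difference
  have hint_eq : ∀ n : ℕ, ∑ k ∈ Finset.range n, ∫ u in (k : ℕ)..((k + 1 : ℕ) : ℝ), g u =
      -(Real.arctan ((w.re + n) / w.im) - Real.arctan (w.re / w.im)) := by
    intro n
    have hint : ∀ k < n, IntervalIntegrable g volume (k : ℕ) ((k + 1 : ℕ) : ℝ) := fun k _ ↦
      ((contDiff_im_one_div_add (n := 0) hy').continuous).intervalIntegrable _ _
    rw [intervalIntegral.sum_integral_adjacent_intervals hint, Nat.cast_zero]
    have h1 : ∫ u in (0 : ℝ)..(n : ℕ), g u = ∫ u in (0 : ℝ)..(n : ℕ), -(w.im / ((w.re + u) ^ 2 + w.im ^ 2)) :=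
      intervalIntegral.integral_congr fun u _ ↦ hgf u
    rw [h1, intervalIntegral.integral_neg, integral_im_kernel hy]
  -- the comparison sequence
  set c : ℕ → ℝ := fun n ↦ (Real.arctan ((w.re + n) / w.im) - Real.arctan (w.re / w.im)) - (g 0 + g n) / 2
    with hc
  have hgn : Tendsto (fun n : ℕ ↦ g n) atTop (𝓝 0) := by
    have hle : ∀ n : ℕ, |g n| ≤ w.im * (1 / (w.re + n) ^ 2) := by
      intro n
      rw [hgf, abs_neg]
      have hpos : 0 < w.re + n := by positivity
      rw [abs_of_nonneg (div_nonneg hy.le (by positivity)), mul_one_div]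
      exact div_le_div_of_nonneg_left hy.le (by positivity) (by nlinarith [sq_nonneg w.im])
    have hlim : Tendsto (fun n : ℕ ↦ w.im * (1 / (w.re + n) ^ 2)) atTop (𝓝 (w.im * 0)) := by
      refine Tendsto.const_mul w.im ?_
      refine tendsto_const_nhds.div_atTop ?_
      have h1 : Tendsto (fun n : ℕ ↦ w.re + n) atTop atTop :=
        tendsto_atTop_add_const_left _ _ tendsto_natCast_atTop_atTop
      exact (tendsto_pow_atTop two_ne_zero).comp h1
    rw [mul_zero] at hlim
    exact squeeze_zero_norm (fun n ↦ by simpa [Real.norm_eq_abs] using hle n) hlim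
  have hatan : Tendsto (fun n : ℕ ↦ Real.arctan ((w.re + n) / w.im) - Real.arctan (w.re / w.im)) atTop
      (𝓝 (π / 2 - Real.arctan (w.re / w.im))) := by
    refine Tendsto.sub_const ?_ _
    have h1 : Tendsto (fun n : ℕ ↦ (w.re + n) / w.im) atTop atTop :=
      Tendsto.atTop_div_const hy (tendsto_atTop_add_const_left _ _ tendsto_natCast_atTop_atTop)
    exact (Real.tendsto_arctan_atTop.mono_right nhdsWithin_le_nhds).comp h1
  have hcl : Tendsto c atTop (𝓝 ((π / 2 - Real.arctan (w.re / w.im)) - g 0 / 2)) := by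
    have h1 := hatan.sub (((tendsto_const_nhds (x := g 0)).add hgn).div_const 2)
    have e : π / 2 - Real.arctan (w.re / w.im) - (g 0 + 0) / 2 = (π / 2 - Real.arctan (w.re / w.im)) - g 0 / 2 := by
      ring
    rw [e] at h1
    exact h1
  -- the key estimate
  have hkey : ∀ n : ℕ, |(-∑ j ∈ Finset.range (n + 1), g j) - c n| ≤ B := by
    intro n
    have hrew : (-∑ j ∈ Finset.range (n + 1), g j) - c n =
        -∑ k ∈ Finset.range n, ((g k + g (k + 1)) / 2 - ∫ u in (k : ℕ)..((k + 1 : ℕ) : ℝ), g u) := by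
      rw [Finset.sum_sub_distrib, hint_eq n, sum_range_succ_eq_sum_trapezoid (fun j ↦ g j) n, hc]
      simp only [Nat.cast_add, Nat.cast_one]
      push_cast
      ring
    rw [hrew, abs_neg]
    calc |∑ k ∈ Finset.range n, ((g k + g (k + 1)) / 2 - ∫ u in (k : ℕ)..((k + 1 : ℕ) : ℝ), g u)|
        ≤ ∑ k ∈ Finset.range n, |(g k + g (k + 1)) / 2 - ∫ u in (k : ℕ)..((k + 1 : ℕ) : ℝ), g u| :=
          Finset.abs_sum_le_sum_abs _ _
      _ ≤ ∑ k ∈ Finset.range n, 1 / (6 * ‖w + k‖ ^ 3) := by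
          refine Finset.sum_le_sum fun k _ ↦ ?_
          have := abs_trapezoid_im_one_div_le hw hy' (Nat.cast_nonneg k)
          simpa [hg] using this
      _ ≤ ∑ k ∈ Finset.range n, (1 / (6 * |w.im|)) * (1 / ‖w + k‖ ^ 2) := by
          refine Finset.sum_le_sum fun k _ ↦ ?_
          have hk : |w.im| ≤ ‖w + k‖ := by
            have := abs_im_le_norm (w + k)
            simpa using this
          have hpos : 0 < ‖w + k‖ := hτ.trans_le hk
          rw [div_mul_div_comm, one_mul, pow_succ, div_le_div_iff₀ (by positivity) (by positivity)]
          nlinarith [pow_pos hpos 2]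
      _ = (1 / (6 * |w.im|)) * ∑ k ∈ Finset.range n, 1 / ‖w + k‖ ^ 2 := by rw [Finset.mul_sum]
      _ ≤ (1 / (6 * |w.im|)) * (1 / ‖w‖ ^ 2 + π / (2 * |w.im|)) := by
          gcongr
          exact sum_inv_norm_add_sq_le hw hy' n
      _ ≤ (1 / (6 * |w.im|)) * (1 / |w.im| ^ 2 + π / (2 * |w.im|)) := by
          gcongr
          exact abs_im_le_norm w
      _ = B := by
          have ht2 : w.im ^ 2 = |w.im| ^ 2 := (sq_abs _).symm
          rw [hB, ht2]
          field_simp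
          ring
  -- pass to the limit
  have hlim := (ha.sub hcl).abs
  have hfinal : |(digamma w).im - ((π / 2 - Real.arctan (w.re / w.im)) - g 0 / 2)| ≤ B :=
    le_of_tendsto' hlim hkey
  have hg0 : g 0 / 2 = (1 / (2 * w)).im := by
    simp only [hg, Complex.ofReal_zero, add_zero]
    rw [show (1 : ℂ) / (2 * w) = ((1 / 2 : ℝ) : ℂ) * (1 / w) by push_cast; ring, im_ofReal_mul]
    ring
  have harg : arg w = π / 2 - Real.arctan (w.re / w.im) := arg_eq_pi_div_two_sub_arctan hw hy
  rw [← hg0, harg]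
  convert hfinal using 2
  ring

/-- **Complex second-order Stirling bound for `ψ` on the open first quadrant**: for `Re w > 0`,
`Im w > 0`, `‖ψ(w) − Log w + 1/(2w)‖ ≤ 2 (1/(6|Im w|³) + π/(12 (Im w)²))` (real part:
`Literature.NumberTheory.LFunctions.Complex.abs_re_digamma_sub_log_norm_add_re_le`; imaginary
part: `abs_im_digamma_sub_arg_add_im_le`). [folklore] -/
theorem norm_digamma_sub_log_add_inv_le {w : ℂ} (hw : 0 < w.re) (hy : 0 < w.im) :
    ‖digamma w - Complex.log w + 1 / (2 * w)‖ ≤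
      2 * (1 / (6 * |w.im| ^ 3) + π / (12 * w.im ^ 2)) := by
  have hre := abs_re_digamma_sub_log_norm_add_re_le hw hy.ne'
  have him := abs_im_digamma_sub_arg_add_im_le hw hy
  have hre' : |(digamma w - Complex.log w + 1 / (2 * w)).re| ≤
      1 / (6 * |w.im| ^ 3) + π / (12 * w.im ^ 2) := by
    rw [Complex.add_re, Complex.sub_re, Complex.log_re]
    exact hre
  have him' : |(digamma w - Complex.log w + 1 / (2 * w)).im| ≤
      1 / (6 * |w.im| ^ 3) + π / (12 * w.im ^ 2) := by
    rw [Complex.add_im, Complex.sub_im, Complex.log_im]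
    exact him
  calc ‖digamma w - Complex.log w + 1 / (2 * w)‖
      ≤ |(digamma w - Complex.log w + 1 / (2 * w)).re| +
          |(digamma w - Complex.log w + 1 / (2 * w)).im| := Complex.norm_le_abs_re_add_abs_im _
    _ ≤ _ := by linarith

/-! ### The Stirling primitive and the `Γ`-ratio along a segment -/

/-- The Stirling primitive `F(w) = (w − ½) Log w − w`, a primitive of `Log w − 1/(2w)` on the slit
plane (the first two terms of Stirling's series for `log Γ`, Whittaker–Watson §12.33, without the
constant `½ log 2π`). [folklore] -/
def stirlingPrim (w : ℂ) : ℂ := (w - 1 / 2) * Complex.log w - w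

/-- `F'(w) = Log w − 1/(2w)` on the slit plane. [folklore] -/
theorem hasDerivAt_stirlingPrim {w : ℂ} (hw : w ∈ slitPlane) :
    HasDerivAt stirlingPrim (Complex.log w - 1 / (2 * w)) w := by
  have hw0 : w ≠ 0 := Complex.slitPlane_ne_zero hw
  have h1 : HasDerivAt (fun w : ℂ ↦ (w - 1 / 2) * Complex.log w)
      (1 * Complex.log w + (w - 1 / 2) * w⁻¹) w :=
    ((hasDerivAt_id w).sub_const _).mul (Complex.hasDerivAt_log hw)
  have h2 := h1.sub (hasDerivAt_id w)
  have e : 1 * Complex.log w + (w - 1 / 2) * w⁻¹ - 1 = Complex.log w - 1 / (2 * w) := by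
    field_simp
    ring
  rw [e] at h2
  exact h2

/-- **The segment integral of `ψ` in Stirling form**: if `[w₀, w₀+d]` lies in the open upper
half-plane and `‖ψ − Log + 1/(2·)‖ ≤ ε` on the segment, then
`‖∫_0^1 ψ(w₀+τd) d dτ − (F(w₀+d) − F(w₀))‖ ≤ ε‖d‖`, `F = stirlingPrim`. [folklore] -/
theorem norm_integral_digamma_seg_sub_stirlingPrim_le {w₀ d : ℂ} {ε : ℝ} (h₀ : 0 < w₀.im)
    (h₁ : 0 < (w₀ + d).im)
    (hψ : ∀ τ ∈ Icc (0:ℝ) 1, ‖digamma (w₀ + τ * d) - Complex.log (w₀ + τ * d) +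
      1 / (2 * (w₀ + τ * d))‖ ≤ ε) :
    ‖(∫ τ in (0:ℝ)..1, digamma (w₀ + τ * d) * d) -
        (stirlingPrim (w₀ + d) - stirlingPrim w₀)‖ ≤ ε * ‖d‖ := by
  have hslit : ∀ τ ∈ Icc (0:ℝ) 1, w₀ + τ * d ∈ slitPlane := fun τ hτ ↦ by
    rw [Complex.mem_slitPlane_iff]; exact Or.inr (im_seg_pos h₀ h₁ hτ).ne'
  have hne : ∀ τ ∈ Icc (0:ℝ) 1, w₀ + τ * d ≠ 0 := fun τ hτ ↦
    Complex.slitPlane_ne_zero (hslit τ hτ)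
  have hsegc : Continuous fun τ : ℝ ↦ w₀ + τ * d := by fun_prop
  -- continuity of the pieces on `[0,1]`
  have hψc : ContinuousOn (fun τ : ℝ ↦ digamma (w₀ + τ * d) * d) (Icc 0 1) := by
    refine ContinuousOn.mul ?_ continuousOn_const
    exact differentiableOn_digamma_im_pos.continuousOn.comp hsegc.continuousOn
      fun τ hτ ↦ im_seg_pos h₀ h₁ hτ
  have hFc : ContinuousOn (fun τ : ℝ ↦ (Complex.log (w₀ + τ * d) - 1 / (2 * (w₀ + τ * d))) * d)
      (Icc 0 1) := by
    refine ContinuousOn.mul (ContinuousOn.sub ?_ ?_) continuousOn_const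
    · intro τ hτ
      refine ContinuousAt.continuousWithinAt ?_
      exact ContinuousAt.comp (g := Complex.log) (continuousAt_clog (hslit τ hτ)) hsegc.continuousAt
    · refine ContinuousOn.div continuousOn_const (by fun_prop) fun τ hτ ↦ ?_
      exact mul_ne_zero two_ne_zero (hne τ hτ)
  -- the main term integrates exactly (fundamental theorem of calculus along the segment)
  have hderiv : ∀ τ ∈ uIcc (0:ℝ) 1, HasDerivAt (fun τ : ℝ ↦ stirlingPrim (w₀ + τ * d))
      ((Complex.log (w₀ + τ * d) - 1 / (2 * (w₀ + τ * d))) * d) τ := by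
    intro τ hτ
    rw [uIcc_of_le zero_le_one] at hτ
    have hi : HasDerivAt (fun z : ℂ ↦ w₀ + z * d) d (τ : ℂ) := by
      simpa using ((hasDerivAt_id (τ : ℂ)).mul_const d).const_add w₀
    have h1 := (hasDerivAt_stirlingPrim (hslit τ hτ)).comp (τ : ℂ) hi
    exact h1.comp_ofReal
  have hmain : ∫ τ in (0:ℝ)..1, (Complex.log (w₀ + τ * d) - 1 / (2 * (w₀ + τ * d))) * d =
      stirlingPrim (w₀ + d) - stirlingPrim w₀ := by
    have hint : IntervalIntegrable
        (fun τ : ℝ ↦ (Complex.log (w₀ + τ * d) - 1 / (2 * (w₀ + τ * d))) * d) volume 0 1 :=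
      (hFc.mono (by rw [Set.uIcc_of_le zero_le_one])).intervalIntegrable
    rw [intervalIntegral.integral_eq_sub_of_hasDerivAt hderiv hint]
    simp
  -- remainder
  set R : ℝ → ℂ := fun τ ↦ digamma (w₀ + τ * d) * d -
    (Complex.log (w₀ + τ * d) - 1 / (2 * (w₀ + τ * d))) * d with hR
  have hRb : ∀ τ ∈ Set.uIoc (0:ℝ) 1, ‖R τ‖ ≤ ε * ‖d‖ := by
    intro τ hτ
    rw [Set.uIoc_of_le zero_le_one] at hτ
    have hτ' : τ ∈ Icc (0:ℝ) 1 := ⟨hτ.1.le, hτ.2⟩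
    have e1 := hψ τ hτ'
    have : R τ = (digamma (w₀ + τ * d) - Complex.log (w₀ + τ * d) + 1 / (2 * (w₀ + τ * d))) * d := by
      simp only [hR]; ring
    rw [this, norm_mul]
    exact mul_le_mul_of_nonneg_right e1 (norm_nonneg d)
  have hsplit : (∫ τ in (0:ℝ)..1, digamma (w₀ + τ * d) * d) -
      (stirlingPrim (w₀ + d) - stirlingPrim w₀) = ∫ τ in (0:ℝ)..1, R τ := by
    rw [← hmain, ← intervalIntegral.integral_sub]
    · exact (hψc.mono (by rw [Set.uIcc_of_le zero_le_one])).intervalIntegrable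
    · exact (hFc.mono (by rw [Set.uIcc_of_le zero_le_one])).intervalIntegrable
  rw [hsplit]
  calc ‖∫ τ in (0:ℝ)..1, R τ‖ ≤ (ε * ‖d‖) * |1 - 0| :=
        intervalIntegral.norm_integral_le_of_norm_le_const hRb
    _ = _ := by simp

/-- **`Γ(w₀+d) = Γ(w₀)·exp(F(w₀+d) − F(w₀) + E)`, `‖E‖ ≤ ε‖d‖`** (`F = stirlingPrim`), whenever
`[w₀, w₀+d]` lies in the open upper half-plane and `‖ψ − Log + 1/(2·)‖ ≤ ε` on the segment.
(Second-order companion of `Gamma_eq_mul_exp_taylor`.) [folklore] -/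
theorem Gamma_eq_mul_exp_stirlingPrim {w₀ d : ℂ} {ε : ℝ} (h₀ : 0 < w₀.im) (h₁ : 0 < (w₀ + d).im)
    (hψ : ∀ τ ∈ Icc (0:ℝ) 1, ‖digamma (w₀ + τ * d) - Complex.log (w₀ + τ * d) +
      1 / (2 * (w₀ + τ * d))‖ ≤ ε) :
    ∃ E : ℂ, ‖E‖ ≤ ε * ‖d‖ ∧
      Gamma (w₀ + d) = Gamma w₀ * Complex.exp (stirlingPrim (w₀ + d) - stirlingPrim w₀ + E) := by
  refine ⟨(∫ τ in (0:ℝ)..1, digamma (w₀ + τ * d) * d) -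
    (stirlingPrim (w₀ + d) - stirlingPrim w₀),
    norm_integral_digamma_seg_sub_stirlingPrim_le h₀ h₁ hψ, ?_⟩
  rw [add_sub_cancel, Gamma_eq_mul_exp_integral_digamma h₀ h₁]
  simp only [add_sub_cancel_left]

/-- **Horizontal segments in the open first quadrant.** For `Re w₀ > 0`, `Im w₀ = b > 0` and a real
shift `δ ≥ 0`: `Γ(w₀+δ) = Γ(w₀)·exp(F(w₀+δ) − F(w₀) + E)` with
`‖E‖ ≤ 2δ (1/(6b³) + π/(12b²))` (`norm_digamma_sub_log_add_inv_le` along the segment, where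
`Im` is constant). [folklore] -/
theorem Gamma_eq_mul_exp_stirlingPrim_horizontal {w₀ : ℂ} {δ : ℝ} (hw : 0 < w₀.re)
    (hy : 0 < w₀.im) (hδ : 0 ≤ δ) :
    ∃ E : ℂ, ‖E‖ ≤ 2 * δ * (1 / (6 * w₀.im ^ 3) + π / (12 * w₀.im ^ 2)) ∧
      Gamma (w₀ + δ) = Gamma w₀ *
        Complex.exp (stirlingPrim (w₀ + δ) - stirlingPrim w₀ + E) := by
  have h₁ : 0 < (w₀ + (δ : ℂ)).im := by simpa using hy
  have hψ : ∀ τ ∈ Icc (0:ℝ) 1, ‖digamma (w₀ + τ * (δ : ℂ)) - Complex.log (w₀ + τ * (δ : ℂ)) +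
      1 / (2 * (w₀ + τ * (δ : ℂ)))‖ ≤ 2 * (1 / (6 * |w₀.im| ^ 3) + π / (12 * w₀.im ^ 2)) := by
    intro τ hτ
    have hre : 0 < (w₀ + τ * (δ : ℂ)).re := by
      simp only [add_re, mul_re, ofReal_re, ofReal_im, zero_mul, sub_zero]
      nlinarith [hτ.1]
    have him : (w₀ + τ * (δ : ℂ)).im = w₀.im := by simp
    have h := norm_digamma_sub_log_add_inv_le hre (by rw [him]; exact hy)
    rw [him] at h
    exact h
  obtain ⟨E, hE, hΓ⟩ := Gamma_eq_mul_exp_stirlingPrim hy h₁ hψ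
  refine ⟨E, hE.trans (le_of_eq ?_), hΓ⟩
  rw [abs_of_pos hy, Complex.norm_real, Real.norm_eq_abs, abs_of_nonneg hδ]
  ring

end Literature.Analysis.SpecialFunctions.Complex
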